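import Summits.QuantumAdvantage.QuantumAdvantage.Theorems.CubicForrelationNearExactIsExactTowerWalk

/-!
# Crux `CubicForrelation.NearExactIsExact` (stmt-QuantumAdvantage-14043), line `direct-sum-amplification` —
stub `window_nonBent_structure`: the STRUCTURE of a non-bent cubic in the window `Φ > 1 − 2⁻¹⁰`

The structure version of the landed tower walk (`tower_walk`, `…TowerWalk.lean`), in the tree's `Bool` / `IsDegLeFun` /
`W` vocabulary (`W_g(x) = Σ_y (−1)^{g(y)} (−1)^{y·x}`). For a CUBIC `g` on `m + m` bits (`2 ≤ m`) that is NOT bent and a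
partner `f` with `Φ(f,g) > 1 − 2⁻¹⁰`, there is a level `⌈2m/3⌉ = (2m+2)/3 ≤ j ≤ m` of the 2-adic Walsh tower with
`W_g = 2^j · u`, `u` integer-valued and NOT everywhere even, whose parity `x ↦ [u(x) odd]` has degree `≤ (3j − 2m)/2` and
whose cost exponent is at least `11`: `(3j − 2m)/2 + 1 + 2(m − j) ≥ 11`. This is the certified shape of every instance of the
open core stub `stub_nonBentBand` (`n ≥ 30`; at `n = 30` it says that every Walsh value is an odd multiple of `2¹⁰`).

Proof (`window_nonBent_structure`). Walk up the tower from the Ax base `j₀ = (2m+2)/3` (`tw_base`): at level `j` with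
`W_g = 2^j u`, the parity of `u` has degree `≤ (3j − 2m)/2` (`stub_walshTower` fed with `stub_axParity`; the side condition is
linear arithmetic). If some `u(x)` is odd, the level is either CHEAP (exponent `≥ 11`) — the witness — or it costs at least
`2⁻¹⁰` of capacity (`stub_levelCapacity` below the bent level, `stub_levelBent` at it, `g` not being bent; `tw_cost_le`), so
`Φ(f,g) ≤ 1 − 2⁻¹⁰` for every `f` (`tw_forrelation_le_of_cap`), contradicting the window. If every `u(x)` is even, the
divisibility lifts one level (`tw_level_up`); at the bent level `j = m` an everywhere-even `u` has the identically-false parity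
(degree `≤ 0`), so `stub_levelBent` gives bent (excluded) or `Φ ≤ 1/2`, again contradicting the window.

Sources: J. Ax (1964) / R. McEliece (1972) divisibility (C. Carlet, *Boolean Functions for Cryptography and Coding Theory*,
CUP 2021, §4.1); O. S. Rothaus, *On "bent" functions*, JCTA 20 (1976); S. Aaronson, A. Ambainis, *Forrelation*, SIAM J.
Comput. 47 (2018) §1.1.1. Everything below is proved from Mathlib and the tree; axioms are the standard three; no definitions.
-/

set_option linter.dupNamespace false -- D-0017: single-problem summit ⇒ `QuantumAdvantage.QuantumAdvantage` by design

noncomputable section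

namespace Summit.QuantumAdvantage.QuantumAdvantage.Theorems.CubicForrelation.NearExactIsExact

open Finset
open Literature.Computability.QuantumComplexity
open Literature.Computability.QuantumComplexity.DerivativeWalsh (W)

/-- **The window structure of a non-bent cubic.** For `2 ≤ m`, a cubic `g` on `m + m` bits that is not bent, and any Boolean
`f` with `Φ(f,g) > 1 − 2⁻¹⁰`: there are a level `(2m+2)/3 ≤ j ≤ m` and an integer-valued `u` with `W_g = 2^j · u`, some `u(x)`
odd, the parity `x ↦ [u(x) odd]` of degree `≤ (3j − 2m)/2`, and cost exponent `(3j − 2m)/2 + 1 + 2(m − j) ≥ 11` (the first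
non-vanishing level of the 2-adic Walsh tower of `g` is CHEAP).  Proof: the tower walk of `…TowerWalk.lean` run as a structure
theorem — an odd level that is not cheap costs `≥ 2⁻¹⁰` of capacity (`stub_levelCapacity` / `stub_levelBent`), an even level
lifts (`tw_level_up`), and an everywhere-even bent level forces `Φ ≤ 1/2`. -/
theorem window_nonBent_structure :
    ∀ (m : ℕ) (f g : (Fin (m + m) → Bool) → Bool), 2 ≤ m → IsDegLeFun 3 g →
      ¬ (∀ x, W (fun y => signOf (g y)) x ^ 2 = (2 : ℝ) ^ (m + m)) →
      1 - 1 / 1024 < forrelation f g →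
      ∃ (j : ℕ) (u : (Fin (m + m) → Bool) → ℤ), (m + m + 2) / 3 ≤ j ∧ j ≤ m ∧
        (∀ x, W (fun y => signOf (g y)) x = (2 : ℝ) ^ j * (u x : ℝ)) ∧ (∃ x, Odd (u x)) ∧
        IsDegLeFun ((3 * j - (m + m)) / 2) (fun x => decide (Odd (u x))) ∧
        11 ≤ (3 * j - (m + m)) / 2 + 1 + 2 * (m - j) := by
  intro m f g hm hg hnb hΦ
  by_contra hne
  -- a capacity bound `Σ|W_g| ≤ 2^{3m}(1 − 2⁻¹⁰)` contradicts the window hypothesis `Φ(f,g) > 1 − 2⁻¹⁰`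
  have hcontra : ¬ ∑ x, |W (fun y => signOf (g y)) x| ≤ (2 : ℝ) ^ (3 * m) * (1 - (1 / 2) ^ 10) := by
    intro hcap
    have := tw_forrelation_le_of_cap f g hcap
    norm_num at this hΦ
    linarith
  -- a level `j₀ ≤ j ≤ m` carrying an odd `u x` is impossible: if cheap (exponent `≥ 11`) it is the excluded witness,
  -- otherwise it costs at least `2⁻¹⁰` of capacity (`stub_levelCapacity` below the bent level, `stub_levelBent` at it)
  have level : ∀ j, (m + m + 2) / 3 ≤ j → j ≤ m → ∀ u : (Fin (m + m) → Bool) → ℤ,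
      (∀ x, W (fun y => signOf (g y)) x = (2 : ℝ) ^ j * (u x : ℝ)) → ¬ ∃ x, Odd (u x) := by
    intro j hj₀ hjm u hu hodd
    have hP : IsDegLeFun ((3 * j - (m + m)) / 2) (fun x => decide (Odd (u x))) :=
      stub_walshTower stub_axParity (m + m) j ((3 * j - (m + m)) / 2) g u hg hu (by intro k hk hkn; omega)
    by_cases h11 : 11 ≤ (3 * j - (m + m)) / 2 + 1 + 2 * (m - j)
    · exact hne ⟨j, u, hj₀, hjm, hu, hodd, hP, h11⟩
    have hc := tw_cost_le (C := 10) (d := (3 * j - (m + m)) / 2) (t := m - j) (by omega)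
    by_cases hjlt : j < m
    · exact hcontra ((stub_levelCapacity m j _ g u hjlt hu hP hodd).trans
        (mul_le_mul_of_nonneg_left (by linarith) (by positivity)))
    · have hjeq : j = m := by omega
      have hu' : ∀ x, W (fun y => signOf (g y)) x = (2 : ℝ) ^ m * (u x : ℝ) := fun x => by rw [hu x, hjeq]
      rcases stub_levelBent m _ g u hu' hP with hbent | hcap
      · exact hnb hbent
      · rw [show m - j = 0 by omega, pow_zero, mul_one] at hc
        exact hcontra (hcap.trans (mul_le_mul_of_nonneg_left (by linarith) (by positivity)))
  -- walk up the tower from the Ax base: by `level` every level has all `u x` even, absurd at the bent level `j = m`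
  -- (induction on the number `t` of levels still to climb from level `j = m - t`)
  have key : ∀ t j, j + t = m → (m + m + 2) / 3 ≤ j → ∀ u : (Fin (m + m) → Bool) → ℤ,
      (∀ x, W (fun y => signOf (g y)) x = (2 : ℝ) ^ j * (u x : ℝ)) → False := by
    intro t
    induction t with
    | zero =>
      intro j hjm hj₀ u hu
      rw [add_zero] at hjm
      have hev : ∀ x, ¬ Odd (u x) := fun x hx => level j hj₀ hjm.le u hu ⟨x, hx⟩
      have hP0 : IsDegLeFun 0 (fun x => decide (Odd (u x))) := by
        have : (fun x => decide (Odd (u x))) = fun _ : Fin (m + m) → Bool => false :=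
          funext fun x => decide_eq_false (hev x)
        rw [this]
        exact isDegLeFun_const 0 false
      have hu' : ∀ x, W (fun y => signOf (g y)) x = (2 : ℝ) ^ m * (u x : ℝ) := fun x => by rw [hu x, hjm]
      rcases stub_levelBent m 0 g u hu' hP0 with hbent | hcap
      · exact hnb hbent
      · exact hcontra (hcap.trans (mul_le_mul_of_nonneg_left (by norm_num) (by positivity)))
    | succ t ih =>
      intro j hjm hj₀ u hu
      have hev : ∀ x, ¬ Odd (u x) := fun x hx => level j hj₀ (by omega) u hu ⟨x, hx⟩
      exact ih (j + 1) (by omega) (by omega) (fun x => u x / 2) (tw_level_up g u hu hev)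
  obtain ⟨u₀, hu₀⟩ := tw_base g hg ((m + m + 2) / 3) rfl
  exact key (m - (m + m + 2) / 3) ((m + m + 2) / 3) (by omega) le_rfl u₀ hu₀

end Summit.QuantumAdvantage.QuantumAdvantage.Theorems.CubicForrelation.NearExactIsExact

end
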